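import Literature.NumberTheory.EllipticCurves.Kato2004.IwasawaCohomology
import HarnessLib

/-!
# Kato 2004 (Astérisque 295) §12.2 with §8.2 / Lemma 8.5, §12.3 and §13.8: the Iwasawa cohomology
# `𝐇¹_Γ(T) = lim←_n H¹(ℤ_n[1/p], T)` of a `p`-adic Galois representation `T` WITH COEFFICIENTS `A`,
# along a `ℤ_p`-extension, as a PINNED `A⟦X⟧`-module interface (`IwasawaH1DataCoeff`) — the
# coefficient-generic form of `Kato2004.IwasawaH1Data`

Topic `NumberTheory/EllipticCurves`, sub-directory `Kato2004` (namespace = path). Written by cell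
`bsd-stepL`'s definition typer (seat `bsd-stepL-defn-ty1`, g23) serving the cite/fact items
`wi-88196` / `wi-88195` of cell `bsd-wall` (route `ResidualThetaTransportAtTwo`, crux
stmt-BirchSwinnertonDyer-26074 `ResidualThetaCountLowerPureAtTwo`, registered skeleton
`Cruxes/ResidualThetaCountLowerPureAtTwo/Lines/bt26_lambda.lean`, stub `stub_cmLambdaLower`): those
items ask for Kato's Thm. 12.4 / 12.5 / 12.6 and Burungale–Tian 2026 Thm. 2.6 for a weight-`2` newform
`g` with `𝒪_λ`-COEFFICIENTS (`𝒪 = padicCoeffIntegers (Set.range ι) ⊂ ℚ̄_p`,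
`Λ_𝒪 = IwasawaAlgebraO (Set.range ι) = 𝒪⟦X⟧`), and every such statement is a statement about
Kato's module `𝐇¹(T)` for a `Gal(ℚ̄/ℚ)`-stable `𝒪_λ`-lattice `T`. The tree's pinned interface
`Kato2004.IwasawaH1Data W p κ γ` (file `Kato2004/IwasawaCohomology.lean`, cell `bsd-smallim`) is written
for ONE representation, `T = T_pW = tateRep W p` with `A = ℤ_p` and `Λ = IwasawaAlgebra p = ℤ_p⟦X⟧`;
its module docstring records `-- TODO(general form): … arbitrary newforms f of weight k ≥ 2 with
coefficients, arbitrary lattices T`. THIS FILE is that general form at the level of the INTERFACE: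
the same structure, field for field, for an arbitrary continuous representation
`T : GaloisRep ℚ A M` of `Gal(ℚ̄/ℚ)` with coefficients in a topological commutative ring `A`, the
Iwasawa algebra being `PowerSeries A = A⟦X⟧` (so that `A = ℤ_p` gives back `IwasawaAlgebra p` and
`A = padicCoeffIntegers S` gives `IwasawaAlgebraO S`, both by `rfl` — these are `abbrev`s for
`PowerSeries _`). HONEST FRAMING: DEFINITIONS with bodies (one hypothesis structure, its projection
family, two conversions) and unfolding / uniqueness lemmas proved from the fields; NOTHING is asserted
— no named fact lives here (the existence of the datum and Thm. 12.4 for newform lattices are the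
business of the companion fact file); BSD is not advanced by this file.

## The printed statements (K. Kato, Astérisque 295 (2004); `[p. N]` = printed page; store key
`paper:doi-10-24033-ast-639`, PDF page `N − 115`; re-read by this seat 2026-08-28, pp. 220–222)

* **§12.2 [p. 220]** "Let `T` be a finitely generated `ℤ_p`-module endowed with a continuous action
  of `Gal(ℚ̄/ℚ)` which is unramified at almost all prime numbers. We denote for `q ∈ ℤ`
  `𝐇^q(T) = lim←_n H^q(ℤ[ζ_{p^n}, 1/p], T)` where `H^q` is the etale cohomology as in 8.2, and the
  inverse limit is taken with respect to trace maps. The following are known: (12.2.1) `𝐇^q(T) = 0`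
  if `q ≠ 1, 2` and `𝐇¹(T)` and `𝐇²(T)` are finitely generated `ℤ_p[[G_∞]]`-modules."
* **§12.3 [p. 221]** "Let `λ` be a place of `F` lying over `p`, `F_λ` the local field of `F` at `λ`,
  `O_λ` the valuation ring of `F_λ` … and let `Λ = O_λ[[G_∞]]`. … **Theorem 12.4.** — Take any
  `Gal(ℚ̄/ℚ)`-stable `O_λ`-lattice `T` of `V_{F_λ}`. Then: (1) `𝐇²(T)` is a torsion `Λ`-module. (2)
  `𝐇¹(T)` is a torsion free `Λ`-module, and `𝐇¹(T) ⊗ ℚ = 𝐇¹(V_{F_λ}(f))` is a free `Λ ⊗ ℚ`-module of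
  rank `1`. (3) If `p ≠ 2` and if `T/m_λT` is irreducible …, `𝐇¹(T)` is a free `Λ`-module of rank
  `1`."  — i.e. for a lattice with coefficients `O_λ` the Iwasawa cohomology is a module over the
  `O_λ`-Iwasawa algebra; along a `ℤ_p`-extension (the `Δ`-trivial component, READING of
  `IwasawaCohomology.lean`) this is `O_λ⟦X⟧`, the `A⟦X⟧` of this file.
* **§8.2 [pp. 180–181], Lemma 8.5 [pp. 183–184]** (integral classes `H¹(O_F[1/p], T) ↪ H¹(F, T)`,
  stated for "a finitely generated `ℤ_p`-module `T` … with a continuous action of `Gal(K̄/K)`" —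
  coefficient-free; the tree's `Kato2004.integralH1 (T : GaloisRep ℚ A M)` is ALREADY generic in the
  coefficient ring `A`, and so are the trace maps `Kato2004.layerCores T κ n` and the norm-compatible
  families `Kato2004.IsNormCompatible T κ` (§12.2) of `IwasawaCohomology.lean`).
* **§13.8 [p. 228]** "`H^q(ℤ[ζ_{p^n}, 1/p], T) ≅ H^q(ℤ[1/p], T ⊗_{O_λ} O_λ[G_n])` … Hence
  `𝐇^q(T) = lim←_n H^q(ℤ[1/p], T ⊗ O_λ[G_n])`" (the `Λ`-structure through the second factor).

## What the structure transcribes (verbatim the design of `IwasawaH1Data`, with `tateRep W p ↦ T`,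
## `ℤ_p ↦ A`, `ℤ_p⟦X⟧ ↦ A⟦X⟧`)

`IwasawaH1DataCoeff T p κ γ` is a HYPOTHESIS STRUCTURE: an abstract `A⟦X⟧`-module `H` together with
additive maps `proj n : H → H¹(ℚ_n, T)` (`ℚ_n` = fixed field of `κ.layerSubgroup n`, the `n`-th layer
of the `ℤ_p`-extension `κ`; `H¹` = the tree's continuous-cochain cohomology `H1 T U`) that (i) land
in the integral classes `integralH1 T p (κ.layerSubgroup n)` (§8.2 / Lemma 8.5), (ii) are compatible
with the corestrictions `ℚ_{n+1} → ℚ_n` ("trace maps", §12.2), (iii) are jointly injective and (iv)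
jointly surjective onto the norm-compatible integral families — (i)–(iv) say
`(proj n)_n : H ≅ lim←_n H¹(ℤ_n[1/p], T)` as abelian groups — and (v) intertwine `X ∈ A⟦X⟧` with
`conj_γ − 1` (`γ` the intended topological generator of `Gal(ℚ_∞/ℚ)`) and (vi) the constants
`a ∈ A ⊂ A⟦X⟧` with the `A`-module structure of the levels.  Nothing is hidden and nothing is
asserted: whether such a datum EXISTS for a given `T` (continuity of the `Γ`-action, completeness of
the levels — (12.2.1) with §13.8) is a named fact to be stated per class of `T` in a fact file, exactly
as `Kato2004.nonempty_iwasawaH1Data` is for `T_pW`.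

PROVED here (no arithmetic content): the family of projections `toFamily` is injective with image the
norm-compatible integral families (`range_toFamily`, `eq_of_toFamily_eq`); extensionality `eq_iff_forall_proj_eq`; the unique
Λ-adic lift of a norm-compatible family (`exists_unique_lift`, Kato Thm. 13.4's sentence "`Z` …
generated by `(z_{p^n})_n`" — the construction statement by which zeta elements enter `𝐇¹`); and the
two CONVERSIONS with the elliptic-curve interface, `IwasawaH1Data.toCoeff` /
`IwasawaH1DataCoeff.toIwasawaH1Data`, inverse to each other (`A = ℤ_p`, `T = tateRep W p`; both
Iwasawa algebras are `PowerSeries ℤ_[p]` by `rfl`), so every `IwasawaH1Data`-consumer statement can be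
fed from the generic interface and conversely.

Scope / NOT here: `𝐇²`, local Iwasawa cohomology, the full `O_λ[[G_∞]]`-module (all
`Δ`-components), Thm. 12.4–12.6 themselves, any existence fact; no `instance` beyond the
structure-projection attributes, no notation.

## References

* K. Kato, *p-adic Hodge theory and values of zeta functions of modular forms*, Astérisque 295 (2004)
  117–290: §8.2 (pp. 180–181), Lemma 8.5 (pp. 183–184), §12.2 (12.2.1) (p. 220), §12.3 and Thm. 12.4
  (p. 221), §13.1 / Thm. 13.4 (pp. 224–226), §13.8 (p. 228). [Kato2004Asterisque]
* K. Rubin, *Euler Systems*, Ann. of Math. Stud. 147 (2000), App. B §2–3 (continuous cohomology with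
  coefficients). [Rubin2000]
* Tree: `Kato2004/IwasawaCohomology.lean` (`IwasawaH1Data`, `integralH1`, `layerCores`,
  `IsNormCompatible` — the pattern and the generic pieces), `GaloisRepresentations/EulerSystem.lean`
  (`H1`), `GaloisRepresentations/ContinuousCorestriction.lean` (`conjMap`, `coresLe`),
  `ZpExtension.lean` (`layerSubgroup`), `SharpFlatPAdicLFunctionCoeffField.lean` (`IwasawaAlgebraO S =
  PowerSeries (padicCoeffIntegers S)`, the newform-coefficient instance of `A⟦X⟧`).
-/

noncomputable section

open scoped NumberField
open Field IsDedekindDomain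
open Literature.NumberTheory.GaloisRepresentations
open Literature.NumberTheory.EllipticCurves Literature.NumberTheory.EllipticCurves.Kato2004
open Literature.NumberTheory.EllipticCurves.Kato2004.EulerSystemValues

namespace Literature.NumberTheory.EllipticCurves.Kato2004

/-! ## §12.2 for a representation `T` with coefficients `A`, along a `ℤ_p`-extension: the pinned
interface `𝐇¹_Γ(T)` over `A⟦X⟧` -/

section Interface

variable {A : Type} [CommRing A] [TopologicalSpace A] {M : Type} [AddCommGroup M] [Module A M]
  [TopologicalSpace M] [IsTopologicalAddGroup M] [ContinuousSMul A M]
  (T : GaloisRep ℚ A M) (p : ℕ) [Fact p.Prime] (κ : ZpExtension ℚ p) (γ : absoluteGaloisGroup ℚ)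

/-- **Kato's `𝐇¹(T) = lim←_n H¹(ℤ[ζ_{p^n}, 1/p], T)` for a continuous representation `T` of
`Gal(ℚ̄/ℚ)` with coefficients `A` (Kato §12.3: "Take any `Gal(ℚ̄/ℚ)`-stable `O_λ`-lattice `T`",
`Λ = O_λ[[G_∞]]`), along the layers of the `ℤ_p`-extension `κ` (Δ-trivial component), as a module
over `A⟦X⟧ = PowerSeries A` with `X = conj_γ − 1` — hypothesis structure; VERBATIM the tree's
`Kato2004.IwasawaH1Data` with `tateRep W p ↦ T` and `ℤ_p ↦ A`.**  Data: an abstract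
`A⟦X⟧`-module `H` and additive maps `proj n : H → H¹(ℚ_n, T)`.  Axioms: `proj_mem` (values in
`H¹(ℤ_n[1/p], T) = integralH1`, §8.2 / Lemma 8.5), `cores_proj` (compatible with the trace maps,
§12.2), `proj_injective` and `proj_surjective` (`(proj n)_n` is a bijection onto the norm-compatible
integral families, i.e. onto `lim←_n H¹(ℤ_n[1/p], T)`), `proj_T_smul` (`X` acts as `conj_γ − 1`) and
`proj_C_smul` (constants `a ∈ A` act through the `A`-module structure of the levels; with §13.8 this is
the `O_λ⟦X⟧`-structure "through the second factor").  Nothing asserted; existence is a per-`T` named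
fact stated elsewhere.
[cite: Kato2004Asterisque, §12.2 (p. 220), §12.3 / Thm. 12.4 (p. 221), §8.2 and Lemma 8.5 (pp. 180–184), §13.8 (p. 228)] -/
structure IwasawaH1DataCoeff where
  /-- The underlying type of the Iwasawa cohomology module `𝐇¹_Γ(T)`. -/
  H : Type
  /-- `𝐇¹` is an abelian group. -/
  [addCommGroup : AddCommGroup H]
  /-- `𝐇¹` is an `A⟦X⟧`-module. -/
  [module : Module (PowerSeries A) H]
  /-- The projection to the `n`-th layer `H¹(ℚ_n, T)`. -/
  proj : ∀ n : ℕ, H →+ H1 T (κ.layerSubgroup n)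
  /-- The projections are integral classes: `proj n x ∈ H¹(ℤ_n[1/p], T)` (§8.2, Lemma 8.5). -/
  proj_mem : ∀ (n : ℕ) (x : H), proj n x ∈ integralH1 T p (κ.layerSubgroup n)
  /-- Compatibility with the trace maps `Cor : H¹(ℚ_{n+1}, T) → H¹(ℚ_n, T)` (§12.2). -/
  cores_proj : ∀ (n : ℕ) (x : H), layerCores T κ n (proj (n + 1) x) = proj n x
  /-- `(proj n)_n` is injective (an element of the inverse limit is determined by its components). -/
  proj_injective : ∀ x : H, (∀ n, proj n x = 0) → x = 0
  /-- `(proj n)_n` is surjective onto the norm-compatible integral families (the inverse limit). -/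
  proj_surjective : ∀ y : (∀ n : ℕ, H1 T (κ.layerSubgroup n)),
    IsNormCompatible T κ y → ∃ x : H, ∀ n, proj n x = y n
  /-- `X` acts as `conj_γ − 1` on every layer. -/
  proj_T_smul : ∀ (n : ℕ) (x : H),
    proj n ((PowerSeries.X : PowerSeries A) • x) =
      conjMap T.toTopRep (κ.layerSubgroup n) γ 1 (proj n x) - proj n x
  /-- Constants `a ∈ A` act through the `A`-module structure of `H¹(ℚ_n, T)`. -/
  proj_C_smul : ∀ (a : A) (n : ℕ) (x : H), proj n (PowerSeries.C a • x) = a • proj n x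

attribute [instance] IwasawaH1DataCoeff.addCommGroup IwasawaH1DataCoeff.module

namespace IwasawaH1DataCoeff

variable {T p κ γ} (I : IwasawaH1DataCoeff T p κ γ)

/-- The family of projections `x ↦ (proj n x)_n : 𝐇¹ → ∏_n H¹(ℚ_n, T)`. [cite: Kato2004Asterisque, §12.2 (p. 220)] -/
def toFamily : I.H →+ (∀ n : ℕ, H1 T (κ.layerSubgroup n)) where
  toFun x n := I.proj n x
  map_zero' := funext fun n ↦ map_zero (I.proj n)
  map_add' x y := funext fun n ↦ map_add (I.proj n) x y

/-- The `n`-th component of `toFamily x` is `proj n x` (unfolding; holds by `rfl`).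
[cite: Kato2004Asterisque, §12.2 (p. 220)] -/
theorem toFamily_apply_eq (x : I.H) (n : ℕ) : I.proj n x = I.toFamily x n := rfl

/-- **Extensionality of `𝐇¹_Γ(T)`:** two elements agree iff they have the same image in every layer
`H¹(ℚ_n, T)` (`proj_injective` applied to the difference). [cite: Kato2004Asterisque, §12.2 (p. 220)] -/
theorem eq_iff_forall_proj_eq {x y : I.H} : x = y ↔ ∀ n, I.proj n x = I.proj n y := by
  refine ⟨fun h n ↦ h ▸ rfl, fun h ↦ ?_⟩
  rw [← sub_eq_zero]
  exact I.proj_injective _ fun n ↦ by rw [map_sub, h n, sub_self]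

/-- Two elements of `𝐇¹_Γ(T)` with the same family of projections are equal (`toFamily` is
injective, written out). [cite: Kato2004Asterisque, §12.2 (p. 220)] -/
theorem eq_of_toFamily_eq {x y : I.H} (h : I.toFamily x = I.toFamily y) : x = y :=
  I.eq_iff_forall_proj_eq.mpr fun n ↦ congr_fun h n

/-- The image of `𝐇¹` in `∏_n H¹(ℚ_n, T)` consists of norm-compatible integral families.
[cite: Kato2004Asterisque, §12.2 (p. 220)] -/
theorem isNormCompatible_toFamily (x : I.H) : IsNormCompatible T κ (I.toFamily x) :=
  ⟨fun n ↦ I.proj_mem n x, fun n ↦ I.cores_proj n x⟩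

/-- The image of `𝐇¹` in `∏_n H¹(ℚ_n, T)` IS the set of norm-compatible integral families
(= the tree's submodule `normCompatible T κ` as a set). [cite: Kato2004Asterisque, §12.2 (p. 220)] -/
theorem range_toFamily : Set.range I.toFamily = {y | IsNormCompatible T κ y} := by
  ext y
  constructor
  · rintro ⟨x, rfl⟩
    exact I.isNormCompatible_toFamily x
  · intro hy
    obtain ⟨x, hx⟩ := I.proj_surjective y hy
    exact ⟨x, funext hx⟩

/-- The image of `toFamily` is the carrier of the tree's `A`-submodule `normCompatible T κ` of
`∏_n H¹(ℚ_n, T)` (Kato §12.2: the inverse limit written inside the product).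
[cite: Kato2004Asterisque, §12.2 (p. 220)] -/
theorem range_toFamily_eq_coe_normCompatible :
    Set.range I.toFamily = (normCompatible (p := p) T κ : Set (∀ n : ℕ, H1 T (κ.layerSubgroup n))) := by
  rw [range_toFamily]
  rfl

/-- **The Λ-adic class of a norm-compatible family (Kato, Thm. 13.4: "`Z` … generated by
`(z_{p^n})_n`"; §13.1).**  A norm-compatible family of integral classes `(y_n)_n` defines a UNIQUE
element `𝐳 ∈ 𝐇¹` with `proj n 𝐳 = y_n` for all `n`.  Immediate from the pin; this is the
CONSTRUCTION statement by which zeta elements of `T` enter `𝐇¹_Γ(T)`.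
[cite: Kato2004Asterisque, §13.1 and Thm. 13.4 (pp. 224–226)] -/
theorem exists_unique_lift {y : ∀ n : ℕ, H1 T (κ.layerSubgroup n)} (hy : IsNormCompatible T κ y) :
    ∃! x : I.H, ∀ n, I.proj n x = y n := by
  obtain ⟨x, hx⟩ := I.proj_surjective y hy
  exact ⟨x, hx, fun x' hx' ↦ I.eq_iff_forall_proj_eq.mpr fun n ↦ by rw [hx n, hx' n]⟩

/-- The Λ-adic class of a norm-compatible integral family (a choice of the unique lift of
`exists_unique_lift`). [cite: Kato2004Asterisque, §13.1 and Thm. 13.4 (pp. 224–226)] -/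
def lift {y : ∀ n : ℕ, H1 T (κ.layerSubgroup n)} (hy : IsNormCompatible T κ y) : I.H :=
  (I.exists_unique_lift hy).choose

/-- The defining property of `lift`: its `n`-th projection is `y_n`.
[cite: Kato2004Asterisque, §13.1 and Thm. 13.4 (pp. 224–226)] -/
@[simp] theorem proj_lift {y : ∀ n : ℕ, H1 T (κ.layerSubgroup n)} (hy : IsNormCompatible T κ y)
    (n : ℕ) : I.proj n (I.lift hy) = y n :=
  (I.exists_unique_lift hy).choose_spec.1 n

/-- Uniqueness of `lift`: any element with the projections `y_n` is `lift hy`.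
[cite: Kato2004Asterisque, §13.1 and Thm. 13.4 (pp. 224–226)] -/
theorem eq_lift_of_proj_eq {y : ∀ n : ℕ, H1 T (κ.layerSubgroup n)} (hy : IsNormCompatible T κ y)
    {x : I.H} (hx : ∀ n, I.proj n x = y n) : x = I.lift hy :=
  I.eq_iff_forall_proj_eq.mpr fun n ↦ by rw [hx n, I.proj_lift hy n]

/-- `proj n` is `A`-linear for the structure `a ↦ C a` on `A⟦X⟧` (restatement of `proj_C_smul` with a
general element: `proj n ((C a * g) • x) = a • proj n (g • x)`).
[cite: Kato2004Asterisque, §12.2 (p. 220) and §13.8 (p. 228)] -/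
theorem proj_C_mul_smul (a : A) (g : PowerSeries A) (n : ℕ) (x : I.H) :
    I.proj n ((PowerSeries.C a * g) • x) = a • I.proj n (g • x) := by
  rw [mul_smul, I.proj_C_smul]

/-- The projection `proj n` as an `A`-LINEAR map, for the `A`-module structure on `𝐇¹` obtained by
restricting scalars along `C : A → A⟦X⟧` (`Module.compHom`); this is how a consumer reads `𝐇¹_Γ(T)`
as an `O_λ`-module (Kato §13.8). [cite: Kato2004Asterisque, §13.8 (p. 228)] -/
def projₗ (n : ℕ) :
    letI : Module A I.H := Module.compHom I.H (PowerSeries.C (R := A))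
    I.H →ₗ[A] H1 T (κ.layerSubgroup n) :=
  letI : Module A I.H := Module.compHom I.H (PowerSeries.C (R := A))
  { toFun := I.proj n
    map_add' := map_add (I.proj n)
    map_smul' := fun a x ↦ I.proj_C_smul a n x }

/-- Unfolding `projₗ`. [cite: Kato2004Asterisque, §13.8 (p. 228)] -/
theorem projₗ_apply (n : ℕ) (x : I.H) : I.projₗ n x = I.proj n x := rfl

/-- `X^k` acts on the `n`-th layer as `(conj_γ − 1)^k` (iterate of `proj_T_smul`).
[cite: Kato2004Asterisque, §12.2 (p. 220) and §13.8 (p. 228)] -/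
theorem proj_X_pow_smul (n k : ℕ) (x : I.H) :
    I.proj n ((PowerSeries.X : PowerSeries A) ^ k • x) =
      (fun c ↦ conjMap T.toTopRep (κ.layerSubgroup n) γ 1 c - c)^[k] (I.proj n x) := by
  induction k generalizing x with
  | zero => simp
  | succ k ih =>
    rw [pow_succ', mul_smul, I.proj_T_smul, ih, Function.iterate_succ_apply']

end IwasawaH1DataCoeff

end Interface

/-! ## The elliptic-curve interface is the case `A = ℤ_p`, `T = T_pW` (conversions, inverse to each
other; both Iwasawa algebras are `PowerSeries ℤ_[p]` definitionally) -/

section EllipticCurve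

variable {W : WeierstrassCurve ℚ} [W.IsElliptic] {p : ℕ} [Fact p.Prime]
  [ContinuousSMul ℤ_[p] (W.tateModule p)] {κ : ZpExtension ℚ p} {γ : absoluteGaloisGroup ℚ}

/-- An `IwasawaH1Data W p κ γ` (the tree's pinned `𝐇¹_Γ(T_pW)` over `IwasawaAlgebra p = ℤ_p⟦X⟧`) IS
an `IwasawaH1DataCoeff (tateRep W p) p κ γ` (coefficients `A = ℤ_p`): field for field.
[cite: Kato2004Asterisque, §12.2 (p. 220) and §12.3 (p. 221)] -/
def IwasawaH1Data.toCoeff (I : IwasawaH1Data W p κ γ) : IwasawaH1DataCoeff (tateRep W p) p κ γ where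
  H := I.H
  proj := I.proj
  proj_mem := I.proj_mem
  cores_proj := I.cores_proj
  proj_injective := I.proj_injective
  proj_surjective := I.proj_surjective
  proj_T_smul := I.proj_T_smul
  proj_C_smul := I.proj_C_smul

/-- Conversely, an `IwasawaH1DataCoeff (tateRep W p) p κ γ` IS an `IwasawaH1Data W p κ γ`.
[cite: Kato2004Asterisque, §12.2 (p. 220) and §12.3 (p. 221)] -/
def IwasawaH1DataCoeff.toIwasawaH1Data (J : IwasawaH1DataCoeff (tateRep W p) p κ γ) :
    IwasawaH1Data W p κ γ where
  H := J.H
  proj := J.proj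
  proj_mem := J.proj_mem
  cores_proj := J.cores_proj
  proj_injective := J.proj_injective
  proj_surjective := J.proj_surjective
  proj_T_smul := J.proj_T_smul
  proj_C_smul := J.proj_C_smul

/-- The two conversions are inverse (elliptic-curve side). [cite: Kato2004Asterisque, §12.2 (p. 220)] -/
@[simp] theorem IwasawaH1Data.toIwasawaH1Data_toCoeff (I : IwasawaH1Data W p κ γ) :
    I.toCoeff.toIwasawaH1Data = I := by
  cases I
  rfl

/-- The two conversions are inverse (coefficient side). [cite: Kato2004Asterisque, §12.2 (p. 220)] -/
@[simp] theorem IwasawaH1DataCoeff.toCoeff_toIwasawaH1Data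
    (J : IwasawaH1DataCoeff (tateRep W p) p κ γ) : J.toIwasawaH1Data.toCoeff = J := by
  cases J
  rfl

/-- The underlying module is unchanged by the conversion. [cite: Kato2004Asterisque, §12.2 (p. 220)] -/
theorem IwasawaH1Data.toCoeff_H (I : IwasawaH1Data W p κ γ) : I.toCoeff.H = I.H := rfl

/-- The projections are unchanged by the conversion. [cite: Kato2004Asterisque, §12.2 (p. 220)] -/
theorem IwasawaH1Data.toCoeff_proj (I : IwasawaH1Data W p κ γ) (n : ℕ) (x : I.H) :
    I.toCoeff.proj n x = I.proj n x := rfl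

/-- `IwasawaH1Data W p κ γ` is inhabited iff `IwasawaH1DataCoeff (tateRep W p) p κ γ` is: the tree's
named fact `Kato2004.nonempty_iwasawaH1Data` is exactly the `T = T_pW` case of the generic existence
statement. [cite: Kato2004Asterisque, §12.2 (12.2.1) (p. 220) and §13.8 (p. 228)] -/
theorem nonempty_iwasawaH1Data_iff_coeff :
    Nonempty (IwasawaH1Data W p κ γ) ↔ Nonempty (IwasawaH1DataCoeff (tateRep W p) p κ γ) :=
  ⟨fun ⟨I⟩ ↦ ⟨I.toCoeff⟩, fun ⟨J⟩ ↦ ⟨J.toIwasawaH1Data⟩⟩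

end EllipticCurve

end Literature.NumberTheory.EllipticCurves.Kato2004

end
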